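import Mathlib.Combinatorics.Enumerative.DoubleCounting
import Literature.NumberTheory.Automorphic.SphericalNotSquareIntegrableRankOne
import HarnessLib

/-!
# Distance-regular Hecke neighbours determine the shell sizes: `#(K tⁿ K / K) = (a+1)b(ab)^{n-1}` by double counting
# (Serre *Trees* II.1.1; Cartier 1979 §IV.1; Macdonald 1971 Ch. V)

Topic `NumberTheory/Automorphic`; namespace `Literature.NumberTheory.Automorphic.SphericalCoefficient`.  THEOREMS ONLY; no definition,
no named fact, no instance, no notation, no `sorry`.  Cell `hodgecm-mathlib`, fan-B row #79 (XP `Rogawski1990.XiPinSphericalCofinite`)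
pay-down, road (B) «local», brick (L4γ): removes the shell-size hypothesis `#(KtⁿK/K) = d_n` of ★
`SphericalCoefficient.not_isSquareIntegrableModCenter_of_isSpherical` (L4β).  If the `(a+1)b` radius-one neighbours `tⁿ x K` (`xK ⊆ KtK`) of
the vertex `tⁿK` contain `ab` vertices of the shell `K t^{n+1} K` and exactly `1` of the shell `K t^{n-1} K` (`n ≥ 1`), and the neighbour
relation is SYMMETRIC (`t⁻¹ ∈ KtK`, as for every group with a Weyl element in `K` inverting `t`), then counting the edges between consecutive
shells in two ways (Mathlib `Finset.card_mul_eq_card_mul`) gives `#(Kt^{n+1}K/K) · 1 = #(KtⁿK/K) · ab`, whence `#(KtⁿK/K) = (a+1)b(ab)^{n-1}` —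
for the semi-homogeneous tree this is the number of vertices at even distance `2n` [SerreTrees1980 II.1.1], for `U(3)` unramified
`(q³+1)q·q^{4(n-1)}`.  HC_CM is proved only modulo the printed citations until rung 0 closes; this file is unconditional and generic.

## What is formalised (`D_m = K t^m K`, `O_m = KtᵐK/K ⊆ G⧸K` its finite set of cosets)
* §1 plumbing: two-sided `K`-invariance of `D_m`, inversion-stability of `KtK` under `t⁻¹ ∈ KtK`, the neighbour count
  `c(g, m) = #{q ∈ O_1 : g·q̃ ∈ D_m}` and its invariance `c(k g k', m) = c(g, m)` (`neighbourCount_mul_mem`), its value at `g = tⁿ`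
  (`neighbourCount_pow_eq_ncard`).
* §2 **`card_orbit_succ_eq`** (`#O_{n+1} = ab · #O_n`, `n ≥ 1`; `#O_1 = (a+1)b`), **`card_orbit_pow_eq`** (`#O_n = d_n`),
  **`exists_transversal_card_eq`** (transversals `X_n` of `KtⁿK/K` with `#X_n = d_n`, the input of L4β).
* §3 **`not_isSquareIntegrableModCenter_of_isSpherical_of_symm`** — L4β with the shell-size hypothesis discharged.
-/

noncomputable section

open MeasureTheory MulAction
open scoped Pointwise

namespace Literature.NumberTheory.Automorphic.SphericalCoefficient

/-! ## §1 Neighbour counts -/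

section Counts

variable {G : Type*} [Group G] {K : Subgroup G}

/-- Two-sided `K`-invariance of a double coset: `x ∈ KsK ⇒ k x k' ∈ KsK`. [cite: CartierCorvallis1979, §IV.1] -/
theorem mul_mul_mem_doubleCoset {s x k k' : G} (hx : x ∈ DoubleCoset.doubleCoset s (K : Set G) K) (hk : k ∈ K) (hk' : k' ∈ K) :
    k * x * k' ∈ DoubleCoset.doubleCoset s (K : Set G) K := by
  obtain ⟨k₁, hk₁, k₂, hk₂, rfl⟩ := DoubleCoset.mem_doubleCoset.1 hx
  exact DoubleCoset.mem_doubleCoset.2 ⟨k * k₁, K.mul_mem hk hk₁, k₂ * k', K.mul_mem hk₂ hk', by group⟩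

/-- `k x k' ∈ KsK ↔ x ∈ KsK` for `k, k' ∈ K`. [cite: CartierCorvallis1979, §IV.1] -/
theorem mul_mul_mem_doubleCoset_iff {s x k k' : G} (hk : k ∈ K) (hk' : k' ∈ K) :
    k * x * k' ∈ DoubleCoset.doubleCoset s (K : Set G) K ↔ x ∈ DoubleCoset.doubleCoset s (K : Set G) K := by
  refine ⟨fun h => ?_, fun h => mul_mul_mem_doubleCoset h hk hk'⟩
  have := mul_mul_mem_doubleCoset h (K.inv_mem hk) (K.inv_mem hk')
  simpa [mul_assoc] using this

/-- If `t⁻¹ ∈ KtK` then `KtK` is stable under inversion. [cite: CartierCorvallis1979, §IV.1] -/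
theorem inv_mem_doubleCoset_of_inv_mem {t x : G} (ht : t⁻¹ ∈ DoubleCoset.doubleCoset t (K : Set G) K)
    (hx : x ∈ DoubleCoset.doubleCoset t (K : Set G) K) : x⁻¹ ∈ DoubleCoset.doubleCoset t (K : Set G) K := by
  obtain ⟨k₁, hk₁, k₂, hk₂, rfl⟩ := DoubleCoset.mem_doubleCoset.1 hx
  have : (k₁ * t * k₂)⁻¹ = k₂⁻¹ * t⁻¹ * k₁⁻¹ := by group
  rw [this]
  exact DoubleCoset.doubleCoset_eq_of_mem ht ▸ mul_mul_mem_doubleCoset (DoubleCoset.mem_doubleCoset_self K K t⁻¹) (K.inv_mem hk₂) (K.inv_mem hk₁)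

/-- The representative `q.out` of a coset `q = gK` is `g k` with `k ∈ K`; hence `x · q.out ∈ KsK ↔ x g ∈ KsK`. [cite: CartierCorvallis1979, §IV.1] -/
theorem mul_out_mem_doubleCoset_iff {s x : G} (g : G) :
    x * ((g : G ⧸ K).out) ∈ DoubleCoset.doubleCoset s (K : Set G) K ↔ x * g ∈ DoubleCoset.doubleCoset s (K : Set G) K := by
  obtain ⟨k, hk⟩ := QuotientGroup.mk_out_eq_mul K g
  rw [hk, ← mul_assoc, show x * g * (k : G) = 1 * (x * g) * k by rw [one_mul]]
  exact mul_mul_mem_doubleCoset_iff K.one_mem k.2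

/-- A coset `gK` lies in the shell `K t^m K / K` iff `g ∈ K t^m K` (★ `mem_doubleCoset_iff_mk_mem_orbit`). [cite: CartierCorvallis1979, §IV.1] -/
theorem mk_mem_orbit_iff {s : G} (g : G) : (g : G ⧸ K) ∈ orbit K (s : G ⧸ K) ↔ g ∈ DoubleCoset.doubleCoset s (K : Set G) K :=
  (mem_doubleCoset_iff_mk_mem_orbit s g).symm

/-- **Invariance of the neighbour count**: for `k, k' ∈ K` the number of cosets `q ∈ KtK/K` with `(k g k') q̃ ∈ K s K` equals the number with
`g q̃ ∈ K s K` (`K` permutes `KtK/K`). [cite: CartierCorvallis1979, §IV.1] -/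
theorem neighbourCount_mul_mem {t s g k k' : G} (hk : k ∈ K) (hk' : k' ∈ K) (O : Finset (G ⧸ K))
    (hO : ∀ q : G ⧸ K, q ∈ O ↔ q ∈ orbit K (t : G ⧸ K)) :
    {q | q ∈ O ∧ k * g * k' * q.out ∈ DoubleCoset.doubleCoset s (K : Set G) K}.ncard =
      {q | q ∈ O ∧ g * q.out ∈ DoubleCoset.doubleCoset s (K : Set G) K}.ncard := by
  -- the bijection `q ↦ k' • q`
  have key : ∀ q : G ⧸ K, k * g * k' * q.out ∈ DoubleCoset.doubleCoset s (K : Set G) K ↔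
      g * ((⟨k', hk'⟩ : K) • q).out ∈ DoubleCoset.doubleCoset s (K : Set G) K := by
    intro q
    obtain ⟨y, rfl⟩ := QuotientGroup.mk_surjective q
    have h1 : ((⟨k', hk'⟩ : K) • (y : G ⧸ K)) = ((k' * y : G) : G ⧸ K) := rfl
    rw [h1, mul_out_mem_doubleCoset_iff (x := k * g * k') y, mul_out_mem_doubleCoset_iff (x := g) (k' * y),
      show k * g * k' * y = k * (g * (k' * y)) * 1 by group, mul_mul_mem_doubleCoset_iff hk K.one_mem]
  have himage : {q | q ∈ O ∧ g * q.out ∈ DoubleCoset.doubleCoset s (K : Set G) K} =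
      (fun q => (⟨k', hk'⟩ : K) • q) '' {q | q ∈ O ∧ k * g * k' * q.out ∈ DoubleCoset.doubleCoset s (K : Set G) K} := by
    ext q
    simp only [Set.mem_setOf_eq, Set.mem_image]
    constructor
    · rintro ⟨hq, hmem⟩
      refine ⟨(⟨k', hk'⟩ : K)⁻¹ • q, ⟨?_, ?_⟩, smul_inv_smul _ _⟩
      · rw [hO] at hq ⊢; exact mem_orbit_of_mem_orbit _ hq
      · rw [key, smul_inv_smul]; exact hmem
    · rintro ⟨q', ⟨hq', hmem⟩, rfl⟩
      refine ⟨?_, (key q').1 hmem⟩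
      rw [hO] at hq' ⊢; exact mem_orbit_of_mem_orbit _ hq'
  rw [himage, Set.ncard_image_of_injective _ (MulAction.injective _)]

/-- **The neighbour count at `g = tⁿ` through a transversal**: `#{q ∈ KtK/K : x q̃ ∈ KsK} = #{y ∈ X : x y ∈ KsK}` for a transversal `X` of
`KtK/K`. [cite: CartierCorvallis1979, §IV.1] -/
theorem neighbourCount_eq_ncard_transversal {t s x : G} (O : Finset (G ⧸ K)) (hO : ∀ q : G ⧸ K, q ∈ O ↔ q ∈ orbit K (t : G ⧸ K))
    {X : Finset G} (hX : Set.BijOn (fun y : G => (y : G ⧸ K)) X (orbit K (t : G ⧸ K))) :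
    {q | q ∈ O ∧ x * q.out ∈ DoubleCoset.doubleCoset s (K : Set G) K}.ncard =
      {y | y ∈ X ∧ x * y ∈ DoubleCoset.doubleCoset s (K : Set G) K}.ncard := by
  have himage : {q | q ∈ O ∧ x * q.out ∈ DoubleCoset.doubleCoset s (K : Set G) K} =
      (fun y : G => (y : G ⧸ K)) '' {y | y ∈ X ∧ x * y ∈ DoubleCoset.doubleCoset s (K : Set G) K} := by
    ext q
    simp only [Set.mem_setOf_eq, Set.mem_image]
    constructor
    · rintro ⟨hq, hmem⟩
      obtain ⟨y, hy, rfl⟩ := hX.surjOn ((hO _).1 hq)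
      exact ⟨y, ⟨hy, (mul_out_mem_doubleCoset_iff y).1 hmem⟩, rfl⟩
    · rintro ⟨y, ⟨hy, hmem⟩, rfl⟩
      exact ⟨(hO _).2 (hX.mapsTo hy), (mul_out_mem_doubleCoset_iff y).2 hmem⟩
  rw [himage, (hX.injOn.mono fun y hy => hy.1).ncard_image]

end Counts

/-! ## §2 Double counting between consecutive shells -/

section DoubleCount

variable {G : Type*} [Group G] {K : Subgroup G} {t : G}

/-- The shell `K t⁰ K / K` is the single coset `K`. [cite: SerreTrees1980, II.1.1] -/
theorem orbit_one_eq : orbit K ((1 : G) : G ⧸ K) = {((1 : G) : G ⧸ K)} := by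
  ext q
  rw [MulAction.mem_orbit_iff, Set.mem_singleton_iff]
  constructor
  · rintro ⟨k, rfl⟩
    change (((k : G) * 1 : G) : G ⧸ K) = _
    rw [mul_one, QuotientGroup.eq, mul_one]
    exact K.inv_mem k.2
  · rintro rfl; exact ⟨1, one_smul _ _⟩

/-- **One step of the double count**: if every vertex of the shell `O_n` has exactly `m` neighbours in `O_{n+1}` and every vertex of `O_{n+1}`
has exactly one neighbour in `O_n` (neighbours = cosets `g y K`, `y ∈ X` a transversal of `KtK/K`, a SYMMETRIC relation when `t⁻¹ ∈ KtK`), then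
`#O_{n+1} = m · #O_n`. [cite: SerreTrees1980, II.1.1] -/
theorem card_orbit_succ_eq (hsymm : t⁻¹ ∈ DoubleCoset.doubleCoset t (K : Set G) K) {X : Finset G}
    (hX : Set.BijOn (fun y : G => (y : G ⧸ K)) X (orbit K (t : G ⧸ K))) (O₁ On On' : Finset (G ⧸ K))
    (hO₁ : ∀ q : G ⧸ K, q ∈ O₁ ↔ q ∈ orbit K (t : G ⧸ K)) {n : ℕ}
    (hOn : ∀ q : G ⧸ K, q ∈ On ↔ q ∈ orbit K ((t ^ n : G) : G ⧸ K))
    (hOn' : ∀ q : G ⧸ K, q ∈ On' ↔ q ∈ orbit K ((t ^ (n + 1) : G) : G ⧸ K)) {m : ℕ}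
    (hup : {y | y ∈ X ∧ t ^ n * y ∈ DoubleCoset.doubleCoset (t ^ (n + 1)) (K : Set G) K}.ncard = m)
    (hdown : {y | y ∈ X ∧ t ^ (n + 1) * y ∈ DoubleCoset.doubleCoset (t ^ n) (K : Set G) K}.ncard = 1) :
    On'.card = m * On.card := by
  classical
  -- the neighbour relation on `G ⧸ K`
  let r : (G ⧸ K) → (G ⧸ K) → Prop := fun p p' => p.out⁻¹ * p'.out ∈ DoubleCoset.doubleCoset t (K : Set G) K
  have hr : ∀ g g' : G, r (g : G ⧸ K) (g' : G ⧸ K) ↔ g⁻¹ * g' ∈ DoubleCoset.doubleCoset t (K : Set G) K := by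
    intro g g'
    obtain ⟨k, hk⟩ := QuotientGroup.mk_out_eq_mul K g
    obtain ⟨k', hk'⟩ := QuotientGroup.mk_out_eq_mul K g'
    change ((g : G ⧸ K).out)⁻¹ * (g' : G ⧸ K).out ∈ _ ↔ _
    rw [hk, hk', mul_inv_rev, mul_assoc, ← mul_assoc g⁻¹, ← mul_assoc, mul_mul_mem_doubleCoset_iff (K.inv_mem k.2) k'.2]
  have hrsymm : ∀ p p' : G ⧸ K, r p p' → r p' p := by
    intro p p' h
    have := inv_mem_doubleCoset_of_inv_mem hsymm h
    simpa [r, mul_inv_rev] using this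
  -- row and column counts as neighbour counts through `O₁`
  have hcount : ∀ (A B : Finset (G ⧸ K)) (j : ℕ), (∀ q : G ⧸ K, q ∈ B ↔ q ∈ orbit K ((t ^ j : G) : G ⧸ K)) →
      ∀ p ∈ A, (B.bipartiteAbove r p).card =
        {q | q ∈ O₁ ∧ p.out * q.out ∈ DoubleCoset.doubleCoset (t ^ j) (K : Set G) K}.ncard := by
    intro A B j hB p _
    rw [← Set.ncard_coe_finset, Finset.coe_bipartiteAbove]
    -- bijection `q ↦ (p.out * q.out) K`
    have himage : ({p' | p' ∈ B ∧ r p p'} : Set (G ⧸ K)) =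
        (fun q : G ⧸ K => ((p.out * q.out : G) : G ⧸ K)) ''
          {q | q ∈ O₁ ∧ p.out * q.out ∈ DoubleCoset.doubleCoset (t ^ j) (K : Set G) K} := by
      ext p'
      simp only [Set.mem_setOf_eq, Set.mem_image]
      constructor
      · rintro ⟨hp', hrp⟩
        refine ⟨((p.out⁻¹ * p'.out : G) : G ⧸ K), ⟨(hO₁ _).2 ((mk_mem_orbit_iff _).2 hrp), ?_⟩, ?_⟩
        · rw [mul_out_mem_doubleCoset_iff, mul_inv_cancel_left, ← mk_mem_orbit_iff, QuotientGroup.out_eq']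
          exact (hB _).1 hp'
        · obtain ⟨k, hk⟩ := QuotientGroup.mk_out_eq_mul K (p.out⁻¹ * p'.out)
          rw [hk, show p.out * (p.out⁻¹ * p'.out * (k : G)) = p'.out * k by group]
          have : ((p'.out * (k : G) : G) : G ⧸ K) = ((p'.out : G) : G ⧸ K) :=
            QuotientGroup.eq.2 (by rw [mul_inv_rev, mul_assoc, inv_mul_cancel, mul_one]; exact K.inv_mem k.2)
          rw [this, QuotientGroup.out_eq']
      · rintro ⟨q, ⟨hq, hmem⟩, rfl⟩
        refine ⟨(hB _).2 ((mk_mem_orbit_iff _).2 hmem), ?_⟩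
        have h := (hr p.out (p.out * q.out)).2 (by rw [inv_mul_cancel_left]; exact (mk_mem_orbit_iff _).1 (by rw [QuotientGroup.out_eq']; exact (hO₁ _).1 hq))
        rwa [QuotientGroup.out_eq'] at h
    have hinj : Set.InjOn (fun q : G ⧸ K => ((p.out * q.out : G) : G ⧸ K))
        {q | q ∈ O₁ ∧ p.out * q.out ∈ DoubleCoset.doubleCoset (t ^ j) (K : Set G) K} := by
      rintro q ⟨-, -⟩ q' ⟨-, -⟩ h
      have h' : ((q.out : G) : G ⧸ K) = ((q'.out : G) : G ⧸ K) := by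
        rw [QuotientGroup.eq] at h ⊢; simpa [mul_inv_rev, mul_assoc] using h
      rwa [QuotientGroup.out_eq', QuotientGroup.out_eq'] at h'
    rw [himage, hinj.ncard_image]
  -- rows: `p ∈ On` has `m` neighbours in `On'`
  have hrow : ∀ p ∈ On, (On'.bipartiteAbove r p).card = m := by
    intro p hp
    rw [hcount On On' (n + 1) hOn' p hp]
    have hpD : p.out ∈ DoubleCoset.doubleCoset (t ^ n) (K : Set G) K :=
      (mk_mem_orbit_iff _).1 (by rw [QuotientGroup.out_eq']; exact (hOn _).1 hp)
    obtain ⟨k, hk, k', hk', hpk⟩ := DoubleCoset.mem_doubleCoset.1 hpD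
    rw [hpk, neighbourCount_mul_mem hk hk' O₁ hO₁, neighbourCount_eq_ncard_transversal O₁ hO₁ hX, hup]
  -- columns: `p' ∈ On'` has exactly one neighbour in `On` (symmetry of `r`)
  have hcol : ∀ p' ∈ On', (On.bipartiteBelow r p').card = 1 := by
    intro p' hp'
    have hswap : On.bipartiteBelow r p' = On.bipartiteAbove r p' := by
      ext p; simp only [Finset.mem_bipartiteBelow, Finset.mem_bipartiteAbove]
      exact ⟨fun h => ⟨h.1, hrsymm _ _ h.2⟩, fun h => ⟨h.1, hrsymm _ _ h.2⟩⟩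
    rw [hswap, hcount On' On n hOn p' hp']
    have hpD : p'.out ∈ DoubleCoset.doubleCoset (t ^ (n + 1)) (K : Set G) K :=
      (mk_mem_orbit_iff _).1 (by rw [QuotientGroup.out_eq']; exact (hOn' _).1 hp')
    obtain ⟨k, hk, k', hk', hpk⟩ := DoubleCoset.mem_doubleCoset.1 hpD
    rw [hpk, neighbourCount_mul_mem hk hk' O₁ hO₁, neighbourCount_eq_ncard_transversal O₁ hO₁ hX, hdown]
  have h := Finset.card_mul_eq_card_mul r hrow hcol
  rw [mul_one] at h
  rw [← h, mul_comm]

/-- **The shell sizes**: under the hypotheses of `card_orbit_succ_eq` for all `n ≥ 1`, with `#X = (a+1)b` and the `ab`-count of upward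
neighbours, `#(K tⁿ K / K) = (a+1)b(ab)^{n-1}` for `n ≥ 1` (and `= 1` for `n = 0`). [cite: SerreTrees1980, II.1.1] [cite: Macdonald1971, Ch. V §3] -/
theorem card_orbit_pow_eq {a b : ℕ} (hfin : ∀ n : ℕ, (orbit K ((t ^ n : G) : G ⧸ K)).Finite)
    (hsymm : t⁻¹ ∈ DoubleCoset.doubleCoset t (K : Set G) K) {X : Finset G}
    (hX : Set.BijOn (fun y : G => (y : G ⧸ K)) X (orbit K (t : G ⧸ K))) (hcard : X.card = (a + 1) * b)
    (hreg : ∀ n, 1 ≤ n →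
      {y | y ∈ X ∧ t ^ n * y ∈ DoubleCoset.doubleCoset (t ^ (n + 1)) (K : Set G) K}.ncard = a * b ∧
      {y | y ∈ X ∧ t ^ n * y ∈ DoubleCoset.doubleCoset (t ^ (n - 1)) (K : Set G) K}.ncard = 1) (n : ℕ) :
    (hfin n).toFinset.card = if n = 0 then 1 else (a + 1) * b * (a * b) ^ (n - 1) := by
  have hO : ∀ j (q : G ⧸ K), q ∈ (hfin j).toFinset ↔ q ∈ orbit K ((t ^ j : G) : G ⧸ K) := fun j q => Set.Finite.mem_toFinset _
  have hO₁ : ∀ q : G ⧸ K, q ∈ (hfin 1).toFinset ↔ q ∈ orbit K (t : G ⧸ K) := fun q => by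
    rw [hO 1 q, pow_one]
  induction n with
  | zero =>
    rw [if_pos rfl, ← Set.ncard_eq_toFinset_card _ (hfin 0), pow_zero, orbit_one_eq, Set.ncard_singleton]
  | succ n ih =>
    rw [if_neg (Nat.succ_ne_zero n)]
    rcases Nat.eq_zero_or_pos n with rfl | hn
    · -- `#O_1 = (a+1) b`: every `y ∈ X` lies in `KtK`
      have hup : {y | y ∈ X ∧ t ^ 0 * y ∈ DoubleCoset.doubleCoset (t ^ (0 + 1)) (K : Set G) K}.ncard = (a + 1) * b := by
        rw [← hcard, ← Set.ncard_coe_finset]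
        congr 1
        ext y
        simp only [Set.mem_setOf_eq, Finset.mem_coe, pow_zero, one_mul, zero_add, pow_one, and_iff_left_iff_imp]
        exact fun hy => (mk_mem_orbit_iff y).1 (hX.mapsTo hy)
      have hdown : {y | y ∈ X ∧ t ^ (0 + 1) * y ∈ DoubleCoset.doubleCoset (t ^ 0) (K : Set G) K}.ncard = 1 := by
        simpa using (hreg 1 le_rfl).2
      rw [card_orbit_succ_eq hsymm hX _ _ _ hO₁ (hO 0) (hO (0 + 1)) hup hdown, ih]
      simp
    · have hup := (hreg n hn).1
      have hdown : {y | y ∈ X ∧ t ^ (n + 1) * y ∈ DoubleCoset.doubleCoset (t ^ n) (K : Set G) K}.ncard = 1 := by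
        simpa using (hreg (n + 1) (by omega)).2
      rw [card_orbit_succ_eq hsymm hX _ _ _ hO₁ (hO n) (hO (n + 1)) hup hdown, ih, if_neg (by omega)]
      obtain ⟨k, rfl⟩ : ∃ k, n = k + 1 := ⟨n - 1, by omega⟩
      simp only [Nat.add_sub_cancel, pow_succ]
      ring

/-- **Transversals of the shells with the right size**: for every `n` there is a transversal `X_n` of `K tⁿ K / K` with
`#X_n = d_n` (`d₀ = 1`, `d_n = (a+1)b(ab)^{n-1}`) — the shell-size input of ★ `not_isSquareIntegrableModCenter_of_isSpherical`.
[cite: SerreTrees1980, II.1.1] [cite: Macdonald1971, Ch. V §3] -/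
theorem exists_transversal_card_eq {a b : ℕ} (hfin : ∀ n : ℕ, (orbit K ((t ^ n : G) : G ⧸ K)).Finite)
    (hsymm : t⁻¹ ∈ DoubleCoset.doubleCoset t (K : Set G) K) {X : Finset G}
    (hX : Set.BijOn (fun y : G => (y : G ⧸ K)) X (orbit K (t : G ⧸ K))) (hcard : X.card = (a + 1) * b)
    (hreg : ∀ n, 1 ≤ n →
      {y | y ∈ X ∧ t ^ n * y ∈ DoubleCoset.doubleCoset (t ^ (n + 1)) (K : Set G) K}.ncard = a * b ∧
      {y | y ∈ X ∧ t ^ n * y ∈ DoubleCoset.doubleCoset (t ^ (n - 1)) (K : Set G) K}.ncard = 1) (n : ℕ) :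
    ∃ Xn : Finset G, Set.BijOn (fun y : G => (y : G ⧸ K)) Xn (orbit K ((t ^ n : G) : G ⧸ K)) ∧
      (Xn.card : ℝ) = if n = 0 then (1 : ℝ) else ((a : ℝ) + 1) * b * ((a : ℝ) * b) ^ (n - 1) := by
  classical
  refine ⟨(hfin n).toFinset.image Quotient.out, ⟨fun y hy => ?_, fun y hy y' hy' h => ?_, fun q hq => ?_⟩, ?_⟩
  · obtain ⟨q, hq, rfl⟩ := Finset.mem_image.1 (Finset.mem_coe.1 hy)
    change ((q.out : G) : G ⧸ K) ∈ _
    rw [QuotientGroup.out_eq']; exact (Set.Finite.mem_toFinset _).1 hq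
  · obtain ⟨q, -, rfl⟩ := Finset.mem_image.1 (Finset.mem_coe.1 hy)
    obtain ⟨q', -, rfl⟩ := Finset.mem_image.1 (Finset.mem_coe.1 hy')
    have h' : q = q' := by simpa using h
    rw [h']
  · refine ⟨q.out, Finset.mem_coe.2 (Finset.mem_image.2 ⟨q, (Set.Finite.mem_toFinset _).2 hq, rfl⟩), ?_⟩
    exact QuotientGroup.out_eq' q
  · rw [Finset.card_image_of_injective _ (fun q q' h => by simpa using congrArg (QuotientGroup.mk (s := K)) h),
      card_orbit_pow_eq hfin hsymm hX hcard hreg n]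
    split_ifs <;> push_cast <;> ring

end DoubleCount

/-! ## §3 L★ with the shell sizes discharged -/

section Main

variable {G V : Type*} [Group G] [TopologicalSpace G] [IsTopologicalGroup G] [AddCommGroup V] [Module ℂ V]
  [MeasurableSpace (G ⧸ Subgroup.center G)] [BorelSpace (G ⧸ Subgroup.center G)]
  {ρ : Representation ℂ G V} {K : Subgroup G}

/-- **`K`-spherical + symmetric distance-regular radius-one neighbours of type `(ab, b-1, 1)` with `b ≤ a`, `ab ≥ 2` ⇒ not square-integrable
modulo the centre** — ★ `not_isSquareIntegrableModCenter_of_isSpherical` with the shell sizes `#(KtⁿK/K)` COMPUTED by `card_orbit_pow_eq`.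
Remaining hypotheses on `(G, K, t)`: `K` compact open ⊇ `Z(G)`; `t⁻¹ ∈ KtK`; the shells `K tⁿ K` pairwise disjoint; one transversal `X` of
`KtK/K` with `#X = (a+1)b` whose translates `tⁿ x K` split `ab ∕ b-1 ∕ 1` over the shells `n+1 ∕ n ∕ n-1` for every `n ≥ 1`.
[cite: Macdonald1971, Ch. V §3] [cite: HarishChandra1970, Part I §1 p. 4] [cite: SerreTrees1980, II.1.1] -/
theorem not_isSquareIntegrableModCenter_of_isSpherical_of_symm {a b : ℕ} (hba : b ≤ a) (hab : 2 ≤ a * b)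
    (hKo : IsOpen (K : Set G)) (hKc : IsCompact (K : Set G)) (hZK : Subgroup.center G ≤ K) {t : G}
    (hsymm : t⁻¹ ∈ DoubleCoset.doubleCoset t (K : Set G) K)
    (hD : ∀ m n : ℕ, m ≠ n → Disjoint (DoubleCoset.doubleCoset (t ^ m) (K : Set G) K) (DoubleCoset.doubleCoset (t ^ n) (K : Set G) K))
    {X : Finset G} (hX : Set.BijOn (fun x : G => (x : G ⧸ K)) X (orbit K (t : G ⧸ K))) (hcard : X.card = (a + 1) * b)
    (hreg : ∀ n, 1 ≤ n →
      {x | x ∈ X ∧ t ^ n * x ∈ DoubleCoset.doubleCoset (t ^ (n + 1)) (K : Set G) K}.ncard = a * b ∧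
      {x | x ∈ X ∧ t ^ n * x ∈ DoubleCoset.doubleCoset (t ^ n) (K : Set G) K}.ncard = b - 1 ∧
      {x | x ∈ X ∧ t ^ n * x ∈ DoubleCoset.doubleCoset (t ^ (n - 1)) (K : Set G) K}.ncard = 1 ∧
      ∀ x ∈ X, t ^ n * x ∈ DoubleCoset.doubleCoset (t ^ (n + 1)) (K : Set G) K ∨
        t ^ n * x ∈ DoubleCoset.doubleCoset (t ^ n) (K : Set G) K ∨
        t ^ n * x ∈ DoubleCoset.doubleCoset (t ^ (n - 1)) (K : Set G) K)
    (hρ : ρ.IsSmooth) (h1 : ρ.IsSpherical K) (μ : Measure (G ⧸ Subgroup.center G)) [μ.IsHaarMeasure] :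
    ¬ ρ.IsSquareIntegrableModCenter μ := by
  classical
  haveI := isHeckeTriple_top_of_isCompact_isOpen K hKc hKo
  have hfin : ∀ n : ℕ, (orbit K ((t ^ n : G) : G ⧸ K)).Finite := fun n => finite_orbit_quotient K _
  have hreg' : ∀ n, 1 ≤ n →
      {y | y ∈ X ∧ t ^ n * y ∈ DoubleCoset.doubleCoset (t ^ (n + 1)) (K : Set G) K}.ncard = a * b ∧
      {y | y ∈ X ∧ t ^ n * y ∈ DoubleCoset.doubleCoset (t ^ (n - 1)) (K : Set G) K}.ncard = 1 :=
    fun n hn => ⟨(hreg n hn).1, (hreg n hn).2.2.1⟩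
  have hex := exists_transversal_card_eq hfin hsymm hX hcard hreg'
  -- the transversals: `X` itself at `n = 1`, the chosen ones elsewhere
  let Xf : ℕ → Finset G := fun n => if n = 1 then X else Classical.choose (hex n)
  have hXf : ∀ n, Set.BijOn (fun x : G => (x : G ⧸ K)) (Xf n) (orbit K ((t ^ n : G) : G ⧸ K)) := by
    intro n
    by_cases hn : n = 1
    · subst hn; simpa [Xf] using hX
    · simpa [Xf, hn] using (Classical.choose_spec (hex n)).1
  have hcardf : ∀ n, ((Xf n).card : ℝ) = if n = 0 then (1 : ℝ) else ((a : ℝ) + 1) * b * ((a : ℝ) * b) ^ (n - 1) := by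
    intro n
    by_cases hn : n = 1
    · subst hn; simp [Xf, hcard]
    · simpa [Xf, hn] using (Classical.choose_spec (hex n)).2
  have hX1 : Xf 1 = X := by simp [Xf]
  exact not_isSquareIntegrableModCenter_of_isSpherical hba hab hKo hKc hZK hD hXf hcardf (by rw [hX1]; exact hreg) hρ h1 μ

end Main

end Literature.NumberTheory.Automorphic.SphericalCoefficient

end
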